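import Summits.Langlands.Langlands.Theorems.LevelOneDyadicPotential

/-!
# Level-one dyadic companions, part 7b: KERNELS of the POTENTIAL normal form (lens-4 g11 node `PotentialNormalForm`)

Necessity (PC ⟸ R, T, E, `Langlands`), exactness (R ⟸ PC ∧ BT ∧ HER ∧ G ∧ I and R ⟺ PC modulo the print/attackable pieces),
the BC3 sub-statements POT / SPREAD with PC ⟸ POT ∧ SPREAD, and the composition to `_root_.Langlands` through part 5's
`langlands_of_pieces₉`.  Vocabulary, the pieces PC / BT / HER / CI and the heredity kernel are part 7a
(`Theorems/LevelOneDyadicPotential.lean`).  decomp-langlands lens-4 g11; landed by census-1 g14 as the tree twin of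
HOME/nodes/lens-4-g11-PotentialNormalForm.lean (cut in two at the 400-line limit; statements byte-identical).  0 sorry; axioms standard.
-/

set_option linter.dupNamespace false

namespace Summit.Langlands.Langlands.Theorems.LevelOneDyadic.Potential

open scoped NumberField
open Filter IsDedekindDomain
open Literature.NumberTheory.GaloisRepresentations Literature.NumberTheory.Automorphic Literature.NumberTheory.PAdicHodge
open Summit.Langlands.Langlands.Theorems.LevelOneDyadic (IsPinnedGeometric IsCrystallineAbove IsUnramifiedAwayFrom IsDeRhamAbove
  CompanionMatch DyadicContinuousCompanion DyadicCompanionExistence DyadicDeRhamRigidity DyadicIrreducibilityTransfer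
  DyadicLevelTransfer dyadicContinuousCompanion_iff dyadicDeRhamRigidity_iff dyadicIrreducibilityTransfer_iff
  dyadicContinuousCompanion_of_langlands dyadicContinuousCompanion_of_E dyadicCompanionExistence_of_TG eventually_natCast_notMem
  dyadicDeRhamRigidity_of_langlands dyadicIrreducibilityTransfer_of_langlands)
open Summit.Langlands.Langlands.Theorems.LevelOneDyadic.Clifford (HasDyadicCompanion DimSlice IsLieIrreducible
  LieIrreducibleCompanion CliffordCompanionStep lieIrreducibleCompanion_iff cliffordCompanionStep_iff
  dyadicContinuousCompanion_of_pieces dyadicContinuousCompanion_iff_pieces dyadicCompanionExistence_of_pieces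
  lieIrreducibleCompanion_of_T cliffordCompanionStep_of_T langlands_of_pieces₉)
open Summit.Langlands.Langlands.Theorems.LevelOneDyadic.TensorCore (ArtinTensorCore CliffordTateShapes cliffordCompanionStep_of_shapes
  langlands_of_pieces₁₀β)

/-! ## KERNEL I — NECESSITY: PC follows from R (hence from T, E, `Langlands`) -/

section Necessity

variable {K : Type} [Field K] [NumberField K] {ℓ : ℕ} [Fact ℓ.Prime] {n : ℕ}

/-- **CI ⟸ G ∧ I** (pure logic: over L, ρ|Γ_L is irreducible by Lie-irreducibility; G gives de Rham above 2, I irreducibility). -/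
theorem towerCompanionIrreducibility_of_GI (hG : DyadicDeRhamRigidity) (hI : DyadicIrreducibilityTransfer) :
    TowerCompanionIrreducibility := by
  rw [dyadicDeRhamRigidity_iff] at hG
  rw [dyadicIrreducibilityTransfer_iff] at hI
  rw [towerCompanionIrreducibility_iff]
  intro K _ _ n hn ℓ _ hℓ ι ρ _hirr hLie _hgeo _hcrys _hlvl L _ _ _ ι₂ hgeoL hcrysL hlvlL σ₂ hur hmatch
  have hirrL : (ρ.restrictField L).toGaloisRep.IsIrreducible := hLie L
  have hdR : IsDeRhamAbove σ₂ := hG L n hn ℓ hℓ ι (ρ.restrictField L) hirrL hgeoL hcrysL hlvlL ι₂ σ₂ hur hmatch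
  exact hI L n hn ℓ hℓ ι (ρ.restrictField L) hirrL hgeoL hcrysL hlvlL ι₂ σ₂ ⟨hur, hdR⟩ hmatch

/-- **NECESSITY CERTIFICATE: `Langlands ⟹ CI`.** -/
theorem towerCompanionIrreducibility_of_langlands (hLg : _root_.Langlands) : TowerCompanionIrreducibility :=
  towerCompanionIrreducibility_of_GI (dyadicDeRhamRigidity_of_langlands hLg) (dyadicIrreducibilityTransfer_of_langlands hLg)

omit [NumberField K] in
/-- **Lie-irreducibility is hereditary**: `ρ|Γ_M` is Lie-irreducible if ρ is (restriction along a tower is restriction up to a change of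
frame, `SorensenPatching.nonempty_equiv_restrictField_restrictField`; irreducibility is invariant, `Representation.isIrreducible_of_equiv`). -/
theorem isLieIrreducible_restrictField (ρ : FramedGaloisRep K (PadicAlgCl ℓ) n) (h : IsLieIrreducible ρ)
    (M : Type) [Field M] [NumberField M] [Algebra K M] : IsLieIrreducible (ρ.restrictField M) := by
  intro L _ _ _
  letI : Algebra K L := ((algebraMap M L).comp (algebraMap K M)).toAlgebra
  haveI : IsScalarTower K M L := IsScalarTower.of_algebraMap_eq fun _ => rfl
  obtain ⟨e⟩ := SorensenPatching.nonempty_equiv_restrictField_restrictField K M L ρ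
  haveI : (ρ.restrictField L).toGaloisRep.toRepresentation.IsIrreducible := h L
  exact Literature.RepresentationTheory.Semisimple.Representation.isIrreducible_of_equiv e.toRepEquiv

/-- **R ⟹ PC** (take L := K; on ANY layer M, ρ|Γ_M is irreducible and Lie-irreducible, and R over M applies under PC's guards). -/
theorem potentialCompanions_of_R (hR : LieIrreducibleCompanion) : PotentialCompanions := by
  rw [lieIrreducibleCompanion_iff] at hR
  rw [potentialCompanions_iff]
  intro K _ _ n hn ℓ _ hℓ ι ρ _hirr hLie _hgeo _hcrys _hlvl ι₂
  refine ⟨K, inferInstance, inferInstance, inferInstance, inferInstance, ?_⟩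
  intro M _ _ _ _ _ _hsol hgeoM hcrysM hlvlM
  exact hR M n hn ℓ hℓ ι (ρ.restrictField M) (hLie M) (isLieIrreducible_restrictField ρ hLie M) hgeoM hcrysM hlvlM ι₂

/-- **T ⟹ PC** (the same with T: only irreducibility of ρ|Γ_M is needed). -/
theorem potentialCompanions_of_T (hT : DyadicContinuousCompanion) : PotentialCompanions :=
  potentialCompanions_of_R (lieIrreducibleCompanion_of_T hT)

/-- PC ⟸ E (tree twin of stmt-Langlands-31932). -/
theorem potentialCompanions_of_E (hE : DyadicCompanionExistence) : PotentialCompanions :=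
  potentialCompanions_of_T (dyadicContinuousCompanion_of_E hE)

/-- **NECESSITY CERTIFICATE: `Langlands ⟹ PC`.** -/
theorem potentialCompanions_of_langlands (hLg : _root_.Langlands) : PotentialCompanions :=
  potentialCompanions_of_T (dyadicContinuousCompanion_of_langlands hLg)

end Necessity

/-! ## KERNEL II — EXACTNESS: R ⟸ PC ∧ BT ∧ HER ∧ G ∧ I («every counterexample to R is persistent»), R ⟺ PC mod (BT, HER, G, I) -/

section Exactness

/-- **THE REDUCTION THEOREM — every counterexample to R is persistent.**  Given PC's Galois extension L/K for (ρ, ι₂): HER makes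
every layer ρ|Γ_M level one, so PC's guarded layer companions are layer companions (BT (a)); HER makes ρ|Γ_L level one, so CI makes
every a.e.-unramified companion of ρ|Γ_L irreducible (BT (b)); BT descends to K. -/
theorem lieIrreducibleCompanion_of_pieces (hPC : PotentialCompanions) (hBT : BrauerTaylorDescent) (hH : LevelOneHeredity)
    (hCI : TowerCompanionIrreducibility) : LieIrreducibleCompanion := by
  rw [potentialCompanions_iff] at hPC
  rw [brauerTaylorDescent_iff] at hBT
  rw [levelOneHeredity_iff] at hH
  rw [towerCompanionIrreducibility_iff] at hCI
  rw [lieIrreducibleCompanion_iff]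
  intro K _ _ n hn ℓ _ hℓ ι ρ hirr hLie hgeo hcrys hlvl ι₂
  obtain ⟨L, _, _, _, _, hlay⟩ := hPC K n hn ℓ hℓ ι ρ hirr hLie hgeo hcrys hlvl ι₂
  refine hBT K n ℓ ι ι₂ ρ L ?_ ?_
  · intro M _ _ _ _ _ hsol
    obtain ⟨h₁, h₂, h₃⟩ := hH K M n ℓ ρ hgeo hcrys hlvl
    exact hlay M hsol h₁ h₂ h₃
  · obtain ⟨hgeoL, hcrysL, hlvlL⟩ := hH K L n ℓ ρ hgeo hcrys hlvl
    exact hCI K n hn ℓ hℓ ι ρ hirr hLie hgeo hcrys hlvl L ι₂ hgeoL hcrysL hlvlL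

/-- **R ⟸ PC ∧ BT ∧ HER ∧ G ∧ I** (CI discharged by the route's Galois-side cruxes G = 31994 and I = 31934). -/
theorem lieIrreducibleCompanion_of_pieces' (hPC : PotentialCompanions) (hBT : BrauerTaylorDescent) (hH : LevelOneHeredity)
    (hG : DyadicDeRhamRigidity) (hI : DyadicIrreducibilityTransfer) : LieIrreducibleCompanion :=
  lieIrreducibleCompanion_of_pieces hPC hBT hH (towerCompanionIrreducibility_of_GI hG hI)

/-- **R ⟺ PC modulo the print/attackable pieces BT, HER, CI** (the split loses nothing). -/
theorem lieIrreducibleCompanion_iff_potential (hBT : BrauerTaylorDescent) (hH : LevelOneHeredity)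
    (hCI : TowerCompanionIrreducibility) : LieIrreducibleCompanion ↔ PotentialCompanions :=
  ⟨potentialCompanions_of_R, fun hPC => lieIrreducibleCompanion_of_pieces hPC hBT hH hCI⟩

/-- The same with CI discharged: **R ⟺ PC mod (BT, HER, G, I)**. -/
theorem lieIrreducibleCompanion_iff_potential' (hBT : BrauerTaylorDescent) (hH : LevelOneHeredity) (hG : DyadicDeRhamRigidity)
    (hI : DyadicIrreducibilityTransfer) : LieIrreducibleCompanion ↔ PotentialCompanions :=
  lieIrreducibleCompanion_iff_potential hBT hH (towerCompanionIrreducibility_of_GI hG hI)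

/-- **T ⟸ PC ∧ BT ∧ HER ∧ G ∧ I ∧ D′** (part 5's induction on the dimension on top). -/
theorem dyadicContinuousCompanion_of_pieces₁₁ (hPC : PotentialCompanions) (hBT : BrauerTaylorDescent) (hH : LevelOneHeredity)
    (hG : DyadicDeRhamRigidity) (hI : DyadicIrreducibilityTransfer) (hS : CliffordCompanionStep) : DyadicContinuousCompanion :=
  dyadicContinuousCompanion_of_pieces (lieIrreducibleCompanion_of_pieces' hPC hBT hH hG hI) hS

/-- **T ⟺ PC ∧ D′ modulo (BT, HER, G, I).** -/
theorem dyadicContinuousCompanion_iff_pieces₁₁ (hBT : BrauerTaylorDescent) (hH : LevelOneHeredity) (hG : DyadicDeRhamRigidity)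
    (hI : DyadicIrreducibilityTransfer) : DyadicContinuousCompanion ↔ (PotentialCompanions ∧ CliffordCompanionStep) :=
  ⟨fun hT => ⟨potentialCompanions_of_T hT, cliffordCompanionStep_of_T hT⟩,
    fun h => dyadicContinuousCompanion_of_pieces₁₁ h.1 hBT hH hG hI h.2⟩

/-- E (tree twin of stmt-Langlands-31932) from the pieces: part 4's glue `E ⟸ T ∧ G` on top. -/
theorem dyadicCompanionExistence_of_pieces₁₁ (hPC : PotentialCompanions) (hBT : BrauerTaylorDescent) (hH : LevelOneHeredity)
    (hS : CliffordCompanionStep) (hG : DyadicDeRhamRigidity) (hI : DyadicIrreducibilityTransfer) : DyadicCompanionExistence :=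
  dyadicCompanionExistence_of_pieces (lieIrreducibleCompanion_of_pieces' hPC hBT hH hG hI) hS hG

/-- **E ⟸ PC ∧ BT ∧ HER ∧ CI ∧ G ∧ TF ∧ C♯** — the k = 4β re-split of E (critic-cleared L592) with R replaced by PC and the three supports
BT, HER, CI: the shape of the gen-2 re-split `--into [PotentialCompanions, DyadicDeRhamRigidity, ArtinTensorCore, CliffordTateShapes]`. -/
theorem dyadicCompanionExistence_of_resplit5β (hPC : PotentialCompanions) (hBT : BrauerTaylorDescent) (hH : LevelOneHeredity)
    (hCI : TowerCompanionIrreducibility) (hG : DyadicDeRhamRigidity) (hT : ArtinTensorCore) (hC : CliffordTateShapes) :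
    DyadicCompanionExistence :=
  dyadicCompanionExistence_of_pieces (lieIrreducibleCompanion_of_pieces hPC hBT hH hCI) (cliffordCompanionStep_of_shapes hC hT) hG

end Exactness

/-! ## BC3 material for PC — two named sub-statements and the composition PC ⟸ POT ∧ SPREAD (pure logic) -/

/-- [stub 1 of PC · POT · WEAKER than PC?  No: INCOMPARABLE by logic, WEAKER than R (`potentialDyadicCompanion_of_R`) · the companion
SOMEWHERE up a finite Galois tower — Deligne's companion problem asked potentially; PRINT = potential automorphy (BLGGT Thm 4.5.1) on its
sector] POTENTIAL DYADIC COMPANION: for ρ as in R and every ι₂ there is a finite Galois L/K on which (if ρ|Γ_L is level one) ρ|Γ_L has a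
continuous a.e.-unramified 2-adic companion through (ι, ι₂). -/
def PotentialDyadicCompanion : Prop :=
  ∀ (K : Type) [Field K] [NumberField K] (n : ℕ), 0 < n → ∀ (ℓ : ℕ) [Fact ℓ.Prime], ℓ ≠ 2 → ∀ (ι : PadicAlgCl ℓ ≃+* ℂ) (ρ : Literature.NumberTheory.GaloisRepresentations.FramedGaloisRep K (PadicAlgCl ℓ) n), ρ.toGaloisRep.IsIrreducible → (∀ (L : Type) [Field L] [NumberField L] [Algebra K L], (ρ.restrictField L).toGaloisRep.IsIrreducible) → ((∀ᶠ v : IsDedekindDomain.HeightOneSpectrum (NumberField.RingOfIntegers K) in cofinite, ρ.IsUnramifiedAt v) ∧ ∀ (v : IsDedekindDomain.HeightOneSpectrum (NumberField.RingOfIntegers K)) (hv : ((ℓ : ℕ) : NumberField.RingOfIntegers K) ∈ v.asIdeal), (Literature.NumberTheory.PAdicHodge.fontainePstAdicCompletion v ℓ hv).IsDeRhamFramed (ρ.toLocal v)) → (∀ (v : IsDedekindDomain.HeightOneSpectrum (NumberField.RingOfIntegers K)) (hv : ((ℓ : ℕ) : NumberField.RingOfIntegers K) ∈ v.asIdeal),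 (Literature.NumberTheory.PAdicHodge.fontainePstAdicCompletion v ℓ hv).IsCrystallineFramed (ρ.toLocal v)) → (∀ w : IsDedekindDomain.HeightOneSpectrum (NumberField.RingOfIntegers K), ((ℓ : ℕ) : NumberField.RingOfIntegers K) ∉ w.asIdeal → ρ.IsUnramifiedAt w) → ∀ (ι₂ : PadicAlgCl 2 ≃+* ℂ), ∃ (L : Type) (_ : Field L) (_ : NumberField L) (_ : Algebra K L) (_ : IsGalois K L), ((∀ᶠ w : IsDedekindDomain.HeightOneSpectrum (NumberField.RingOfIntegers L) in cofinite, (ρ.restrictField L).IsUnramifiedAt w) ∧ ∀ (w : IsDedekindDomain.HeightOneSpectrum (NumberField.RingOfIntegers L)) (hw : ((ℓ : ℕ) : NumberField.RingOfIntegers L) ∈ w.asIdeal), (Literature.NumberTheory.PAdicHodge.fontainePstAdicCompletion w ℓ hw).IsDeRhamFramed ((ρ.restrictField L).toLocal w)) → (∀ (w : IsDedekindDomain.HeightOneSpectrum (NumberField.RingOfIntegers L)) (hw : ((ℓ : ℕ) : NumberField.RingOfIntegers L) ∈ w.asIdeal), (Literature.NumberTheory.PAdicHodge.fontainePstAdicCompletion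 w ℓ hw).IsCrystallineFramed ((ρ.restrictField L).toLocal w)) → (∀ w : IsDedekindDomain.HeightOneSpectrum (NumberField.RingOfIntegers L), ((ℓ : ℕ) : NumberField.RingOfIntegers L) ∉ w.asIdeal → (ρ.restrictField L).IsUnramifiedAt w) → ∃ ρ₂ : Literature.NumberTheory.GaloisRepresentations.FramedGaloisRep L (PadicAlgCl 2) n, (∀ᶠ w : IsDedekindDomain.HeightOneSpectrum (NumberField.RingOfIntegers L) in cofinite, ρ₂.IsUnramifiedAt w) ∧ (∀ᶠ w : IsDedekindDomain.HeightOneSpectrum (NumberField.RingOfIntegers L) in cofinite, ∃ α : Multiset ℂ, (ρ.restrictField L).HasFrobCharpolyAt w (Literature.NumberTheory.Automorphic.arithFrobPolyOfSatake ι w.residueCard 1 α) ∧ ρ₂.HasFrobCharpolyAt w (Literature.NumberTheory.Automorphic.arithFrobPolyOfSatake ι₂ w.residueCard 1 α))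

/-- [stub 2 of PC · SPREAD · WEAKER than PC by logic (`solvableLayerSpreading_of_PC`) · the SOLUBLE-DESCENT content: from one potential
companion to companions on every solvable layer of some finite Galois extension — PRINT in the automorphic sector (BLGHT Lemma 1.4:
RAESDC automorphy descends along soluble Galois extensions when the Galois representation is defined downstairs; Arthur–Clozel cyclic
base change), dark for abstract companions (cyclic descent of an abstract companion fails at inert places: only f-th powers of Frobenius
are seen)] SOLVABLE-LAYER SPREADING. -/
def SolvableLayerSpreading : Prop :=
  ∀ (K : Type) [Field K] [NumberField K] (n : ℕ), 0 < n → ∀ (ℓ : ℕ) [Fact ℓ.Prime], ℓ ≠ 2 → ∀ (ι : PadicAlgCl ℓ ≃+* ℂ) (ρ : Literature.NumberTheory.GaloisRepresentations.FramedGaloisRep K (PadicAlgCl ℓ) n), ρ.toGaloisRep.IsIrreducible → (∀ (L : Type) [Field L] [NumberField L] [Algebra K L], (ρ.restrictField L).toGaloisRep.IsIrreducible) → ((∀ᶠ v : IsDedekindDomain.HeightOneSpectrum (NumberField.RingOfIntegers K) in cofinite, ρ.IsUnramifiedAt v) ∧ ∀ (v : IsDedekindDomain.HeightOneSpectrum (NumberField.RingOfIntegers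 K)) (hv : ((ℓ : ℕ) : NumberField.RingOfIntegers K) ∈ v.asIdeal), (Literature.NumberTheory.PAdicHodge.fontainePstAdicCompletion v ℓ hv).IsDeRhamFramed (ρ.toLocal v)) → (∀ (v : IsDedekindDomain.HeightOneSpectrum (NumberField.RingOfIntegers K)) (hv : ((ℓ : ℕ) : NumberField.RingOfIntegers K) ∈ v.asIdeal), (Literature.NumberTheory.PAdicHodge.fontainePstAdicCompletion v ℓ hv).IsCrystallineFramed (ρ.toLocal v)) → (∀ w : IsDedekindDomain.HeightOneSpectrum (NumberField.RingOfIntegers K), ((ℓ : ℕ) : NumberField.RingOfIntegers K) ∉ w.asIdeal → ρ.IsUnramifiedAt w) → ∀ (ι₂ : PadicAlgCl 2 ≃+* ℂ), (∃ (L : Type) (_ : Field L) (_ : NumberField L) (_ : Algebra K L) (_ : IsGalois K L), ((∀ᶠ w : IsDedekindDomain.HeightOneSpectrum (NumberField.RingOfIntegers L) in cofinite, (ρ.restrictField L).IsUnramifiedAt w) ∧ ∀ (w : IsDedekindDomain.HeightOneSpectrum (NumberField.RingOfIntegers L)) (hw : ((ℓ : ℕ) : NumberField.RingOfIntegers L)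 ∈ w.asIdeal), (Literature.NumberTheory.PAdicHodge.fontainePstAdicCompletion w ℓ hw).IsDeRhamFramed ((ρ.restrictField L).toLocal w)) → (∀ (w : IsDedekindDomain.HeightOneSpectrum (NumberField.RingOfIntegers L)) (hw : ((ℓ : ℕ) : NumberField.RingOfIntegers L) ∈ w.asIdeal), (Literature.NumberTheory.PAdicHodge.fontainePstAdicCompletion w ℓ hw).IsCrystallineFramed ((ρ.restrictField L).toLocal w)) → (∀ w : IsDedekindDomain.HeightOneSpectrum (NumberField.RingOfIntegers L), ((ℓ : ℕ) : NumberField.RingOfIntegers L) ∉ w.asIdeal → (ρ.restrictField L).IsUnramifiedAt w) → ∃ ρ₂ : Literature.NumberTheory.GaloisRepresentations.FramedGaloisRep L (PadicAlgCl 2) n, (∀ᶠ w : IsDedekindDomain.HeightOneSpectrum (NumberField.RingOfIntegers L) in cofinite, ρ₂.IsUnramifiedAt w) ∧ (∀ᶠ w : IsDedekindDomain.HeightOneSpectrum (NumberField.RingOfIntegers L) in cofinite, ∃ α : Multiset ℂ, (ρ.restrictField L).HasFrobCharpolyAt w (Literature.NumberTheory.Automorphic.arithFrobPolyOfSatake ι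 w.residueCard 1 α) ∧ ρ₂.HasFrobCharpolyAt w (Literature.NumberTheory.Automorphic.arithFrobPolyOfSatake ι₂ w.residueCard 1 α))) → ∃ (L : Type) (_ : Field L) (_ : NumberField L) (_ : Algebra K L) (_ : IsGalois K L), ∀ (M : Type) [Field M] [NumberField M] [Algebra K M] [Algebra M L] [IsScalarTower K M L], IsSolvable (L ≃ₐ[M] L) → ((∀ᶠ w : IsDedekindDomain.HeightOneSpectrum (NumberField.RingOfIntegers M) in cofinite, (ρ.restrictField M).IsUnramifiedAt w) ∧ ∀ (w : IsDedekindDomain.HeightOneSpectrum (NumberField.RingOfIntegers M)) (hw : ((ℓ : ℕ) : NumberField.RingOfIntegers M) ∈ w.asIdeal), (Literature.NumberTheory.PAdicHodge.fontainePstAdicCompletion w ℓ hw).IsDeRhamFramed ((ρ.restrictField M).toLocal w)) → (∀ (w : IsDedekindDomain.HeightOneSpectrum (NumberField.RingOfIntegers M)) (hw : ((ℓ : ℕ) : NumberField.RingOfIntegers M) ∈ w.asIdeal), (Literature.NumberTheory.PAdicHodge.fontainePstAdicCompletion w ℓ hw).IsCrystallineFramed ((ρ.restrictField M).toLocal w))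 → (∀ w : IsDedekindDomain.HeightOneSpectrum (NumberField.RingOfIntegers M), ((ℓ : ℕ) : NumberField.RingOfIntegers M) ∉ w.asIdeal → (ρ.restrictField M).IsUnramifiedAt w) → ∃ ρ₂ : Literature.NumberTheory.GaloisRepresentations.FramedGaloisRep M (PadicAlgCl 2) n, (∀ᶠ w : IsDedekindDomain.HeightOneSpectrum (NumberField.RingOfIntegers M) in cofinite, ρ₂.IsUnramifiedAt w) ∧ (∀ᶠ w : IsDedekindDomain.HeightOneSpectrum (NumberField.RingOfIntegers M) in cofinite, ∃ α : Multiset ℂ, (ρ.restrictField M).HasFrobCharpolyAt w (Literature.NumberTheory.Automorphic.arithFrobPolyOfSatake ι w.residueCard 1 α) ∧ ρ₂.HasFrobCharpolyAt w (Literature.NumberTheory.Automorphic.arithFrobPolyOfSatake ι₂ w.residueCard 1 α))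

section Skeleton

/-- **PC ⟸ POT ∧ SPREAD** (modus ponens per (ρ, ι₂)). -/
theorem potentialCompanions_of_pot_spread (hP : PotentialDyadicCompanion) (hS : SolvableLayerSpreading) : PotentialCompanions := by
  intro K _ _ n hn ℓ _ hℓ ι ρ hirr hLie hgeo hcrys hlvl ι₂
  exact hS K n hn ℓ hℓ ι ρ hirr hLie hgeo hcrys hlvl ι₂ (hP K n hn ℓ hℓ ι ρ hirr hLie hgeo hcrys hlvl ι₂)

/-- SPREAD ⟸ PC (drop the hypothesis). -/
theorem solvableLayerSpreading_of_PC (hPC : PotentialCompanions) : SolvableLayerSpreading := by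
  intro K _ _ n hn ℓ _ hℓ ι ρ hirr hLie hgeo hcrys hlvl ι₂ _
  exact hPC K n hn ℓ hℓ ι ρ hirr hLie hgeo hcrys hlvl ι₂

/-- POT ⟸ R (L := K). -/
theorem potentialDyadicCompanion_of_R (hR : LieIrreducibleCompanion) : PotentialDyadicCompanion := by
  rw [lieIrreducibleCompanion_iff] at hR
  intro K _ _ n hn ℓ _ hℓ ι ρ _hirr hLie _hgeo _hcrys _hlvl ι₂
  refine ⟨K, inferInstance, inferInstance, inferInstance, inferInstance, ?_⟩
  intro hgeoK hcrysK hlvlK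
  exact hR K n hn ℓ hℓ ι (ρ.restrictField K) (hLie K) (isLieIrreducible_restrictField ρ hLie K) hgeoK hcrysK hlvlK ι₂

/-- POT ⟸ PC (the top layer M := L of PC's extension is a solvable layer: Gal(L/L) = 1). -/
theorem potentialDyadicCompanion_of_PC (hPC : PotentialCompanions) : PotentialDyadicCompanion := by
  rw [potentialCompanions_iff] at hPC
  intro K _ _ n hn ℓ _ hℓ ι ρ hirr hLie hgeo hcrys hlvl ι₂
  obtain ⟨L, _, _, _, _, hlay⟩ := hPC K n hn ℓ hℓ ι ρ hirr hLie hgeo hcrys hlvl ι₂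
  exact ⟨L, inferInstance, inferInstance, inferInstance, inferInstance, hlay L inferInstance⟩

end Skeleton

/-! ## KERNEL III — the pieces + the lineage frame ⟹ `_root_.Langlands` (seventeen binders, through part 5's `langlands_of_pieces₉`) -/

section Closes

open Summit.Langlands.Langlands.Theses

/-- **PC BT HER D′ + G I U + the MinimalLevelDescent frame ⟹ Langlands** (binders typed exactly as part 5's `langlands_of_pieces₉`). -/
theorem langlands_of_pieces₁₁ (hPC : PotentialCompanions) (hBT : BrauerTaylorDescent) (hH : LevelOneHeredity)
    (hS : CliffordCompanionStep) (hG : DyadicDeRhamRigidity) (hI : DyadicIrreducibilityTransfer) (hU : DyadicLevelTransfer)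
    (hK : ResidualInertiaDescent) (hWM : MinimalLevelDescent.WeightMove) (hLM : MinimalLevelDescent.LevelMove)
    (hB : MinimalLevelDescent.DyadicLevelOneAutomorphy) (hL : MinimalLevelDescent.AutomorphyLifting)
    (hW : MinimalLevelDescent.SatakeAvatarExistence) (hP : MinimalLevelDescent.PadicMemberCompatibility)
    (hA : MinimalLevelDescent.CompatibilityAwayFromLR) (hCRD : MinimalLevelDescent.CanonicalReciprocityData) :
    _root_.Langlands :=
  langlands_of_pieces₉ (lieIrreducibleCompanion_of_pieces' hPC hBT hH hG hI) hS hG hI hU hK hWM hLM hB hL hW hP hA hCRD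

/-- k = 5β: **PC BT HER + C♯ TF + G I U + frame ⟹ Langlands** (seventeen binders, through part 6b's `langlands_of_pieces₁₀β`; CI is
not a binder — it is G ∧ I). -/
theorem langlands_of_pieces₁₁β (hPC : PotentialCompanions) (hBT : BrauerTaylorDescent) (hH : LevelOneHeredity)
    (hC : CliffordTateShapes) (hT : ArtinTensorCore) (hG : DyadicDeRhamRigidity) (hI : DyadicIrreducibilityTransfer)
    (hU : DyadicLevelTransfer) (hK : ResidualInertiaDescent) (hWM : MinimalLevelDescent.WeightMove)
    (hLM : MinimalLevelDescent.LevelMove) (hB : MinimalLevelDescent.DyadicLevelOneAutomorphy)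
    (hL : MinimalLevelDescent.AutomorphyLifting) (hW : MinimalLevelDescent.SatakeAvatarExistence)
    (hP : MinimalLevelDescent.PadicMemberCompatibility) (hA : MinimalLevelDescent.CompatibilityAwayFromLR)
    (hCRD : MinimalLevelDescent.CanonicalReciprocityData) : _root_.Langlands :=
  langlands_of_pieces₁₀β (lieIrreducibleCompanion_of_pieces' hPC hBT hH hG hI) hC hT hG hI hU hK hWM hLM hB hL hW hP hA hCRD

end Closes

end Summit.Langlands.Langlands.Theorems.LevelOneDyadic.Potential
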